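import Summits.ABC.ABC.Theses.IneffectiveSubspace
import Summits.ABC.ABC.Theorems.IneffectiveSubspaceAbcGivesTower

/-!
# `AbcGivesUniformSadic`: ABC ⟹ `UniformSadicTowerFour` (item stmt-ABC-15071)

Upper half of the sandwich for crux #2 of route `IneffectiveSubspace`: the abc conjecture implies
the uniform S-adic level-four tower inequality, with abc's own constant `C(ε)` serving every `K`
and every finite set of primes `S`.

For a positive coprime tower point put `a = ∏ x_i^(i+1)`, `b = ∏ y_i^(i+1)`, `c = ∏ z_i^(i+1)` and
`M = ∏ x_i y_i z_i`. Then `(a, b, c)` is an abc triple and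
`rad(abc) = radical(abc) ∣ radical(M) = ∏_{p ∈ M.primeFactors} p`
(`radical(abc) ∣ M`, `AbcGivesTower.radical_dvd_prod`). Splitting
`M.primeFactors = (M.primeFactors ∩ S) ⊔ (M.primeFactors \ S)` gives
`radical(M) ∣ (∏_{p ∈ S} p) · ∏_{p ∈ M.primeFactors \ S} p^{v_p(M)}`; the right-hand side is positive
when `S` consists of primes, so `rad(abc)` is at most it, and `c < C · rad(abc)^(1+ε)` finishes by
monotonicity of `t ↦ C · t^(1+ε)`.

Sources: Vojta, *On the ABC conjecture and Diophantine approximation by rational points*,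
Amer. J. Math. 122 (2000), §3 (the level-`n` towers); the `S`-uniform form is the route's own
bookkeeping. No new definitions; nothing conditional beyond the hypothesis `ABC` built into the
statement.
-/

-- `Summit.<Summit>.<Problem>` is the mandated summit-side namespace (CONVENTIONS §2); for the
-- single-conjunct summit `ABC` the two coincide, so the duplicate `ABC.ABC` is deliberate.
set_option linter.dupNamespace false

namespace Summit.ABC.ABC.Theorems

open scoped BigOperators
open UniqueFactorizationMonoid Literature.NumberTheory.DiophantineGeometry

/-- For `M ≠ 0` and any finite `S ⊆ ℕ`, the radical of `M` divides
`(∏_{p ∈ S} p) · ∏_{p ∈ M.primeFactors \ S} p^{v_p(M)}`: split `∏_{p ∈ M.primeFactors} p` along `S`;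
the part inside `S` divides `∏_{p ∈ S} p`, and off `S` each prime factor `p` of `M` divides
`p^{v_p(M)}` since `v_p(M) ≥ 1`. [folklore] -/
theorem AbcGivesUniformSadic.radical_dvd_sadic {M : ℕ} (hM : M ≠ 0) (S : Finset ℕ) :
    radical M ∣ (∏ p ∈ S, p) * ∏ p ∈ M.primeFactors \ S, p ^ M.factorization p := by
  rw [Nat.radical_eq_prod_primeFactors, ← Finset.prod_inter_mul_prod_sdiff M.primeFactors S]
  refine mul_dvd_mul ?_ ?_
  · exact Finset.prod_dvd_prod_of_subset _ _ _ Finset.inter_subset_right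
  · refine Finset.prod_dvd_prod_of_dvd _ _ fun p hp => ?_
    obtain ⟨hp, hdvd, -⟩ := Nat.mem_primeFactors.mp (Finset.mem_sdiff.mp hp).1
    exact dvd_pow_self p (hp.factorization_pos_of_dvd hM hdvd).ne'

/-- If `S` consists of primes then `(∏_{p ∈ S} p) · ∏_{p ∈ M.primeFactors \ S} p^{v_p(M)}` is
positive. [folklore] -/
theorem AbcGivesUniformSadic.sadic_pos (M : ℕ) (S : Finset ℕ) (hS : ∀ p ∈ S, Nat.Prime p) :
    0 < (∏ p ∈ S, p) * ∏ p ∈ M.primeFactors \ S, p ^ M.factorization p := by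
  refine Nat.mul_pos (Finset.prod_pos fun p hp => (hS p hp).pos) ?_
  exact Finset.prod_pos fun p hp =>
    pow_pos (Nat.pos_of_mem_primeFactors (Finset.mem_sdiff.mp hp).1) _

/-- `rad(a, b, c) ≤ (∏_{p ∈ S} p) · ∏_{p ∈ M.primeFactors \ S} p^{v_p(M)}` for a tower point with
positive coordinates, where `a = ∏ x_i^(i+1)`, `b = ∏ y_i^(i+1)`, `c = ∏ z_i^(i+1)`,
`M = ∏ x_i y_i z_i`, and `S` is a finite set of primes: `radical(abc) ∣ radical(M)` because
`radical(abc) ∣ M` (Vojta 2000, Lemma 3.5), then `AbcGivesUniformSadic.radical_dvd_sadic`.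
[cite: Vojta2000ABC, Lemma 3.5] -/
theorem AbcGivesUniformSadic.rad_le_sadic {n : ℕ} (x y z : Fin n → ℕ)
    (hpos : ∀ i, 0 < x i ∧ 0 < y i ∧ 0 < z i) (S : Finset ℕ) (hS : ∀ p ∈ S, Nat.Prime p) :
    rad (∏ i, x i ^ (i.val + 1)) (∏ i, y i ^ (i.val + 1)) (∏ i, z i ^ (i.val + 1)) ≤
      (∏ p ∈ S, p) * ∏ p ∈ (∏ i, x i * y i * z i).primeFactors \ S,
        p ^ (∏ i, x i * y i * z i).factorization p := by
  rw [rad_def]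
  have hP : 0 < ∏ i, x i * y i * z i := Finset.prod_pos fun i _ =>
    Nat.mul_pos (Nat.mul_pos (hpos i).1 (hpos i).2.1) (hpos i).2.2
  refine Nat.le_of_dvd (AbcGivesUniformSadic.sadic_pos _ S hS) ?_
  have h1 := radical_dvd_radical (AbcGivesTower.radical_dvd_prod x y z) hP.ne'
  rw [radical_radical] at h1
  exact h1.trans (AbcGivesUniformSadic.radical_dvd_sadic hP.ne' S)

/-- **ABC ⟹ UniformSadicTowerFour** (item stmt-ABC-15071, route `IneffectiveSubspace`): under the
abc conjecture, for every `K`, every `ε > 0`, every set `S` of at most `K` primes and every positive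
coprime solution of `x₁x₂²x₃³x₄⁴ + y₁y₂²y₃³y₄⁴ = z₁z₂²z₃³z₄⁴` one has
`∏ z_i^(i+1) < C · ((∏_{p ∈ S} p) · {∏ x_i y_i z_i}^S)^(1+ε)` with abc's own `C = C(ε)`
(independent of `K` and `S`), `{M}^S = ∏_{p ∈ M.primeFactors \ S} p^{v_p(M)}` the `S`-free part.
Proof: `(a, b, c) = (∏ x_i^(i+1), ∏ y_i^(i+1), ∏ z_i^(i+1))` is an abc triple,
`rad(abc) ≤ (∏_{p ∈ S} p) · {∏ x_i y_i z_i}^S` (`AbcGivesUniformSadic.rad_le_sadic`), and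
`t ↦ C · t^(1+ε)` is monotone. [cite: Vojta2000ABC, §3 (proof of Thm 3.12)] -/
theorem abcGivesUniformSadic_proof :
    Summit.ABC.ABC.Theses.IneffectiveSubspace.AbcGivesUniformSadic := by
  unfold Summit.ABC.ABC.Theses.IneffectiveSubspace.AbcGivesUniformSadic
    Summit.ABC.ABC.Theses.IneffectiveSubspace.UniformSadicTowerFour
  intro hABC K ε hε
  obtain ⟨C, hC, h⟩ := (ABC_iff.mp hABC) ε hε
  refine ⟨C, hC, ?_⟩
  intro S _ hS x y z hpos hsum hcop
  have ha : 0 < ∏ i, x i ^ (i.val + 1) := Finset.prod_pos fun i _ => pow_pos (hpos i).1 _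
  have hb : 0 < ∏ i, y i ^ (i.val + 1) := Finset.prod_pos fun i _ => pow_pos (hpos i).2.1 _
  have htriple :
      IsABCTriple (∏ i, x i ^ (i.val + 1)) (∏ i, y i ^ (i.val + 1)) (∏ i, z i ^ (i.val + 1)) :=
    ⟨ha, hb, hsum, hcop⟩
  have hrad :
      ((rad (∏ i, x i ^ (i.val + 1)) (∏ i, y i ^ (i.val + 1)) (∏ i, z i ^ (i.val + 1)) : ℕ) : ℝ) ≤
        (((∏ p ∈ S, p) * ∏ p ∈ (∏ i, x i * y i * z i).primeFactors \ S,
          p ^ (∏ i, x i * y i * z i).factorization p : ℕ) : ℝ) := by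
    exact_mod_cast AbcGivesUniformSadic.rad_le_sadic x y z hpos S hS
  calc ((∏ i, z i ^ (i.val + 1) : ℕ) : ℝ)
      < C * ((rad (∏ i, x i ^ (i.val + 1)) (∏ i, y i ^ (i.val + 1))
          (∏ i, z i ^ (i.val + 1)) : ℕ) : ℝ) ^ (1 + ε) := h _ _ _ htriple
    _ ≤ C * (((∏ p ∈ S, p) * ∏ p ∈ (∏ i, x i * y i * z i).primeFactors \ S,
          p ^ (∏ i, x i * y i * z i).factorization p : ℕ) : ℝ) ^ (1 + ε) := by
      gcongr

end Summit.ABC.ABC.Theorems
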